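import Summits.BirchSwinnertonDyer.BirchSwinnertonDyer.Theorems.AlignedTransportAtTwoMainConjectureOfRankZeroBSDAtTwoRoadSecondFixedPoint
import Literature.NumberTheory.EllipticCurves.KatoRankBoundLevelZeroProofs
import Literature.NumberTheory.EllipticCurves.PAdicLFunctionProofs
import Literature.NumberTheory.EllipticCurves.IwasawaLeadingTermProofs
import Literature.NumberTheory.EllipticCurves.ModularCurvePeriodRatio
import Summits.BirchSwinnertonDyer.Rank1Residual.Supersingular.PlusSymbolParityTwo
import HarnessLib

/-!
# Route `AlignedTransportAtTwo`, crux C2 `MainConjectureOfRankZeroBSDAtTwo` (stmt-BirchSwinnertonDyer-22298):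
# ON THE ROAD `λ₂ ≥ 3` UNDER `μ₂ = 0` — the order of `L₂(W,T)` at `T = 0` is EXACTLY `0` in analytic rank `0`, and the
# `λ = 1` alternative `L₂ = (T+2)·unit` is excluded by `4 ∣ L₂(W,0) = (1 − α⁻¹)²·[0]⁺` whenever the central symbol `[0]⁺` is `2`-integral

HONEST FRAMING (cell `bsd-f1-sign2`, WIDTH-5 attached prover seat `bsd-line-att-p5` gen 33 on line `birth` of the lead
`bsd-line-att-p2`; `--supports` stmt-BirchSwinnertonDyer-22298, closes nothing; BSD is NOT proved by any of this; the crux C2, its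
verdict «blocked-on `Rank1Residual.GreenbergMuConjectureIrreducible`» and every registered stub are untouched). THEOREMS ONLY (no `def`,
no named fact, no `sorry`); every input is a tree THEOREM: the companion files of this seat (`…TwoFixedPointLemma`,
`…TwoFixedPointLambdaParity`, `…RoadSecondFixedPoint`), the interpolation of `L₂(W,T)` at the trivial character
`L₂(W,0) = (1 − α⁻¹)²·[0]⁺_f` and `L₂(W,0) ≠ 0 ↔ L(W,1) ≠ 0` (`constantCoeff_padicLFunction_unitRoot`,
`constantCoeff_padicLFunction_ne_zero_iff`, MTT §I.14), `r_an = 0 ↔ L(W,1) ≠ 0` (`analyticRank_eq_zero_iff_holds`, with the entire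
continuation supplied by the newform, `hasEntireLFunction_of_cuspCoeff_eq`), the unit root `α ∈ ℤ₂^×` (`unitRoot_spec_holds`, `exists_unit_one_sub_unitRoot_inv`); the ONE named fact
that appears (§4 only, binder `hper`) is the road's own PRINT input `realPeriodRat_eq_unit_mul_plusPeriod_two`.

* §1 In analytic rank `0` every integral model `g` of `c·L₂(W,T)`, `c ≠ 0`, has `g(0) ≠ 0`, i.e. `ord_{T=0} g = 0` EXACTLY; hence on the
  road `λ(g) ≡ ord_{T=−2} g (mod 2)` with both ODD (companion file), and the two-fixed-points law reads `λ(g) = ord₋₂ g + 2k`.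
* §2 `2 ∣ α − 1` (every unit of `ℤ₂` is `≡ 1 (mod 2)`), so `‖(1 − α⁻¹)²‖₂ ≤ ¼` and **`‖L₂(W,0)‖₂ ≤ ¼·‖[0]⁺_f‖₂`**: if the central modular
  symbol `[0]⁺_f = L(f,1)/Ω⁺_f ∈ ℚ` is `2`-integral then `4 ∣ L₀(0)` for the integral lift `L₀` of `L₂(W,T)`.
* §3 **`λ₂ ≥ 3` ON THE ROAD UNDER `μ₂ = 0`**: for `W` globally minimal, good ordinary at `2`, `∏ c_v` odd, `Δ_min ≡ 3, 5 (mod 8)`,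
  `r_an(W) = 0`, `f` its newform at level `N_W`, `L₀` the integral lift of `L₂(W,T)` with `μ(L₀) = 0` (C2's own analytic-`μ` hypothesis
  `red L₀ ≠ 0`) and `‖[0]⁺_f‖₂ ≤ 1`: **`3 ≤ λ(L₀)`** — by the companion's `λ = 1` dichotomy, `λ(L₀) = 1` would force `L₀ = (T+2)·u`,
  `‖L₀(0)‖ = ½`, contradicting `4 ∣ L₀(0)`. This is crux memo CHI8-TWIST-att-p5-g32 §2/§6 («`ord₂ L₂(W,0) = 2·ord₂#Ẽ(𝔽₂) ∈ {2,4}` ⟹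
  `λ₂ ≥ 3`», 19/19 road curves with `λ₂ ∈ {3,5,7,11,15}`) as a KERNEL statement with its one arithmetic input displayed (`[0]⁺_f`
  `2`-integral — on the census rows `[0]⁺ = L(W,1)/Ω = 1`).
* §4 In the road's own currency: granted the road's PRINT input `realPeriodRat_eq_unit_mul_plusPeriod_two` (`Ω_W = u·Ω⁺_f`, `‖u‖₂ = 1`, the
  `E[2]`-irreducible slice of Abbes–Ullmo at `2`) and its `L`-value bit «`L(W,1)/Ω_W = q`, `ord₂ q = 0`», `‖[0]⁺_f‖₂ = 1`; hence
  **`λ(L₀) ≥ 3` under `μ(L₀) = 0`** on the odd-`L/Ω` branch of the road (`three_le_lam_integralLift_of_road_of_lValue`).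
* §5 (appended) **`λ₂ ≥ ord_{T=−2} L₂ + 2`** on the road under `μ(L₀) = 0` and `‖[0]⁺_f‖₂ = 1`: `‖L₀(0)‖₂ = ‖#Ẽ(𝔽₂)‖₂²` is an EVEN power of `½`,
  while `L₀ = (T+2)^n·unit` would give the ODD power `2^{−n}` — so beyond the forced odd-order zero at `χ₈` the `2`-adic `L`-function of every
  road curve has a genuine `ι`-PAIR of zeros (`orderAtNegTwo_add_two_le_lam_integralLift_of_road`, `…_of_lValue`).

References: B. Mazur, J. Tate, J. Teitelbaum, Invent. Math. 84 (1986) §I.11, §I.14 (14.3) [MazurTateTeitelbaum1986Invent];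
R. Greenberg, LNM 1716 (1999), §5 p. 181 [GreenbergLNM1716]; L. Washington, GTM 83, §7.1 [Washington1997].
-/

set_option linter.dupNamespace false
set_option autoImplicit false

noncomputable section

open scoped Classical MatrixGroups ModularForm

namespace Summit.BirchSwinnertonDyer.BirchSwinnertonDyer.Theorems.AlignedTransportAtTwoRoadSecondFixedPoint

open PowerSeries CongruenceSubgroup WeierstrassCurve Literature.NumberTheory.EllipticCurves
  Literature.NumberTheory.EllipticCurves.ModularForms Literature.Barriers.BirchSwinnertonDyer
  Summit.BirchSwinnertonDyer.Rank1Residual.Supersingular Summit.BirchSwinnertonDyer.Rank1Residual.F1Sign2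
  Summit.BirchSwinnertonDyer.Rank1Residual.X1.MuLambda
  Summit.BirchSwinnertonDyer.BirchSwinnertonDyer.Theorems.AlignedTransportAtTwoTwoFixedPoints

variable {W : WeierstrassCurve ℚ} [W.IsElliptic] [W.IsGloballyMinimal] [NeZero (W.conductorNorm ℤ)]
  {f : CuspForm (Gamma0 (W.conductorNorm ℤ)) 2}

/-! ## §1 Analytic rank `0`: `ord_{T=0} g = 0` exactly -/

omit [W.IsElliptic] [W.IsGloballyMinimal] in
/-- A newform of `W` supplies the entire continuation of `L(W, s)`. [cite: DiamondShurman2005, Thm. 5.10.2] -/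
theorem hasEntireLFunction_of_isNewformOf (hf : IsNewformOf W f) : W.HasEntireLFunction :=
  W.hasEntireLFunction_of_cuspCoeff_eq (strictWidthInfty_Gamma0 _) f hf.2

/-- In analytic rank `0`, `L₂(W, 0) ≠ 0` (`L₂(W,0) = (1 − α⁻¹)²·L(W,1)/Ω⁺_f`, MTT §I.14). [cite: MazurTateTeitelbaum1986Invent, §I.14 (14.3)] -/
theorem constantCoeff_padicLFunction_ne_zero_of_analyticRank_eq_zero (hord : IsOrdinaryAt W 2) (hf : IsNewformOf W f)
    (hr : W.analyticRank = 0) : constantCoeff (padicLFunction f (unitRoot W 2 : ℚ_[2])) ≠ 0 :=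
  (constantCoeff_padicLFunction_ne_zero_iff W 2 hord hf).mpr
    ((W.analyticRank_eq_zero_iff_holds (hasEntireLFunction_of_isNewformOf hf)).mp hr)

/-- In analytic rank `0` every integral model `g` of `c·L₂(W,T)` with `c ≠ 0` has `g(0) ≠ 0`. [cite: MazurTateTeitelbaum1986Invent, §I.14 (14.3)] -/
theorem constantCoeff_ne_zero_of_analyticRank_eq_zero (hord : IsOrdinaryAt W 2) (hf : IsNewformOf W f)
    (hr : W.analyticRank = 0) {c : ℚ_[2]} (hc : c ≠ 0) {g : PowerSeries ℤ_[2]}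
    (hg : iwasawaToPowerSeries 2 g = C c * padicLFunction f (unitRoot W 2 : ℚ_[2])) : constantCoeff g ≠ 0 := by
  intro h0
  have h := congrArg constantCoeff hg
  have hl : constantCoeff (iwasawaToPowerSeries 2 g) = ((constantCoeff g : ℤ_[2]) : ℚ_[2]) := by
    rw [← coeff_zero_eq_constantCoeff_apply, ← coeff_zero_eq_constantCoeff_apply]
    exact Wuthrich2014.coeff_iwasawaToPowerSeries 2 g 0
  rw [hl, h0, map_mul, constantCoeff_C, PadicInt.coe_zero] at h
  exact mul_ne_zero hc (constantCoeff_padicLFunction_ne_zero_of_analyticRank_eq_zero hord hf hr) h.symm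

/-- **`ord_{T=0} g = 0` exactly in analytic rank `0`.** [cite: MazurTateTeitelbaum1986Invent, §I.14 (14.3)] -/
theorem hasOrderAtZero_zero_of_analyticRank_eq_zero (hord : IsOrdinaryAt W 2) (hf : IsNewformOf W f)
    (hr : W.analyticRank = 0) {c : ℚ_[2]} (hc : c ≠ 0) {g : PowerSeries ℤ_[2]}
    (hg : iwasawaToPowerSeries 2 g = C c * padicLFunction f (unitRoot W 2 : ℚ_[2])) : HasOrderAtZero g 0 := by
  refine ⟨by rw [pow_zero]; exact one_dvd _, ?_⟩
  rw [zero_add, pow_one, PowerSeries.X_dvd_iff]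
  exact constantCoeff_ne_zero_of_analyticRank_eq_zero hord hf hr hc hg

/-- **On the road `λ(g) = ord_{T=−2} g + 2k`** (analytic rank `0`, so `ord₀ g = 0`; the two-fixed-points law). [cite: GreenbergLNM1716, §5 p. 181] -/
theorem even_lam_add_orderAtNegTwo_of_analyticRank_eq_zero (hord : IsOrdinaryAt W 2) (hf : IsNewformOf W f)
    (hr : W.analyticRank = 0) {c : ℚ_[2]} (hc : c ≠ 0) {g : PowerSeries ℤ_[2]}
    (hg : iwasawaToPowerSeries 2 g = C c * padicLFunction f (unitRoot W 2 : ℚ_[2])) {n : ℕ} (hn : HasOrderAtNegTwo g n) :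
    Even (lam g + n) := by
  obtain ⟨e, -, hFE⟩ := exists_integral_functional_equation hord hf hg
  exact even_lam_add_orderAtNegTwo_of_constantCoeff_ne_zero hFE (constantCoeff_ne_zero_of_analyticRank_eq_zero hord hf hr hc hg) hn

/-! ## §2 `2 ∣ α − 1` and `‖L₂(W, 0)‖ ≤ ¼·‖[0]⁺‖` -/

omit [W.IsElliptic] [NeZero (W.conductorNorm ℤ)] in
/-- Every unit of `ℤ₂` is `≡ 1 (mod 2)`: `2 ∣ α − 1` for the unit root `α` of a good ordinary `W` at `2`. [cite: MazurTateTeitelbaum1986Invent, §I.11] -/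
theorem two_dvd_unitRoot_sub_one (hord : IsOrdinaryAt W 2) : (2 : ℤ_[2]) ∣ unitRoot W 2 - 1 := by
  have hu : IsUnit (unitRoot W 2) := ((unitRoot_spec_holds W 2) hord).2
  have hu2 : IsUnit (PadicInt.toZMod (unitRoot W 2)) := hu.map _
  have h1 : PadicInt.toZMod (unitRoot W 2) = 1 := by
    have hne : PadicInt.toZMod (p := 2) (unitRoot W 2) ≠ 0 := hu2.ne_zero
    revert hne; generalize PadicInt.toZMod (p := 2) (unitRoot W 2) = t; revert t; decide
  have hker : unitRoot W 2 - 1 ∈ RingHom.ker (PadicInt.toZMod (p := 2)) := by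
    rw [RingHom.mem_ker, map_sub, h1, map_one, sub_self]
  rw [PadicInt.ker_toZMod, PadicInt.maximalIdeal_eq_span_p, Ideal.mem_span_singleton] at hker
  exact_mod_cast hker

omit [W.IsElliptic] [NeZero (W.conductorNorm ℤ)] in
/-- `‖1 − α⁻¹‖₂ ≤ ½` for the unit root `α`. [cite: MazurTateTeitelbaum1986Invent, §I.11] -/
theorem norm_one_sub_unitRoot_inv_le (hord : IsOrdinaryAt W 2) :
    ‖(1 : ℚ_[2]) - ((unitRoot W 2 : ℤ_[2]) : ℚ_[2])⁻¹‖ ≤ 2⁻¹ := by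
  have hu : IsUnit (unitRoot W 2) := ((unitRoot_spec_holds W 2) hord).2
  have hα1 : ‖((unitRoot W 2 : ℤ_[2]) : ℚ_[2])‖ = 1 := by
    rw [← PadicInt.norm_def]; exact PadicInt.isUnit_iff.mp hu
  have hα0 : ((unitRoot W 2 : ℤ_[2]) : ℚ_[2]) ≠ 0 := by
    intro h; rw [h, norm_zero] at hα1; exact zero_ne_one hα1
  obtain ⟨t, ht⟩ := two_dvd_unitRoot_sub_one hord
  have hsub : (1 : ℚ_[2]) - ((unitRoot W 2 : ℤ_[2]) : ℚ_[2])⁻¹ =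
      (((unitRoot W 2 - 1 : ℤ_[2])) : ℚ_[2]) * ((unitRoot W 2 : ℤ_[2]) : ℚ_[2])⁻¹ := by
    rw [PadicInt.coe_sub, PadicInt.coe_one, sub_mul, mul_inv_cancel₀ hα0, one_mul]
  rw [hsub, norm_mul, norm_inv, hα1, inv_one, mul_one, ← PadicInt.norm_def, ht, norm_mul]
  have h2n : ‖(2 : ℤ_[2])‖ = 2⁻¹ := by
    rw [show (2 : ℤ_[2]) = ((2 : ℕ) : ℤ_[2]) by norm_cast, PadicInt.norm_p]; norm_num
  rw [h2n]
  calc (2 : ℝ)⁻¹ * ‖t‖ ≤ 2⁻¹ * 1 := by gcongr; exact PadicInt.norm_le_one t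
    _ = 2⁻¹ := mul_one _

/-- **`‖L₂(W,0)‖₂ ≤ ¼·‖[0]⁺_f‖₂`** (`L₂(W,0) = (1 − α⁻¹)²·[0]⁺_f`, MTT §I.14 (14.3), and `‖1 − α⁻¹‖ ≤ ½`). [cite: MazurTateTeitelbaum1986Invent, §I.14 (14.3)] -/
theorem norm_constantCoeff_padicLFunction_le (hord : IsOrdinaryAt W 2) (hf : IsNewformOf W f) :
    ‖constantCoeff (padicLFunction f (unitRoot W 2 : ℚ_[2]))‖ ≤ 4⁻¹ * ‖(ratPlusSymbol f 0 : ℚ_[2])‖ := by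
  rw [constantCoeff_padicLFunction_unitRoot hord hf, norm_mul, norm_pow]
  have h := norm_one_sub_unitRoot_inv_le hord
  have h0 : 0 ≤ ‖(1 : ℚ_[2]) - ((unitRoot W 2 : ℤ_[2]) : ℚ_[2])⁻¹‖ := norm_nonneg _
  calc ‖(1 : ℚ_[2]) - ((unitRoot W 2 : ℤ_[2]) : ℚ_[2])⁻¹‖ ^ 2 * ‖(ratPlusSymbol f 0 : ℚ_[2])‖
      ≤ (2⁻¹ : ℝ) ^ 2 * ‖(ratPlusSymbol f 0 : ℚ_[2])‖ := by gcongr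
    _ = 4⁻¹ * ‖(ratPlusSymbol f 0 : ℚ_[2])‖ := by norm_num

/-- **`‖L₂(W,0)‖₂ = ‖#Ẽ(𝔽₂)‖₂²·‖[0]⁺_f‖₂` EXACTLY** — `1 − α⁻¹ = u·#Ẽ(𝔽₂)` with `u ∈ ℤ₂ˣ` (tree `exists_unit_one_sub_unitRoot_inv`,
Balakrishnan–Müller–Stein's remark `ord_p ε_p = 2 ord_p N_p`), so `ord₂ L₂(W,0) = 2·ord₂ #Ẽ(𝔽₂) + ord₂ [0]⁺_f` (crux memo CHI8-TWIST-att-p5-g32 §2: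
`= 2·ord₂#Ẽ(𝔽₂) ∈ {2, 4}` on the rows with `[0]⁺ = 1`). [cite: BalakrishnanMullerStein2015, Thm. 1.7 (remark following)] -/
theorem norm_constantCoeff_padicLFunction_eq (hord : IsOrdinaryAt W 2) (hf : IsNewformOf W f) :
    ‖constantCoeff (padicLFunction f (unitRoot W 2 : ℚ_[2]))‖ =
      ‖(W.reductionPointCount 2 : ℚ_[2])‖ ^ 2 * ‖(ratPlusSymbol f 0 : ℚ_[2])‖ := by
  obtain ⟨u, hu⟩ := exists_unit_one_sub_unitRoot_inv 2 W hord
  have hu1 : ‖((u : ℤ_[2]) : ℚ_[2])‖ = 1 := by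
    rw [← PadicInt.norm_def]; exact PadicInt.isUnit_iff.mp u.isUnit
  rw [constantCoeff_padicLFunction_unitRoot hord hf, norm_mul, norm_pow, hu, norm_mul, hu1, one_mul]

/-- **`4 ∣ L₀(0)` for the integral lift `L₀` of `L₂(W,T)` when `[0]⁺_f` is `2`-integral** (`‖L₀(0)‖₂ ≤ ¼`).
[cite: MazurTateTeitelbaum1986Invent, §I.14 (14.3)] -/
theorem norm_constantCoeff_integralLift_le (hord : IsOrdinaryAt W 2) (hf : IsNewformOf W f)
    {L₀ : PowerSeries ℤ_[2]} (hL₀ : iwasawaToPowerSeries 2 L₀ = padicLFunction f (unitRoot W 2 : ℚ_[2]))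
    (hsym : ‖(ratPlusSymbol f 0 : ℚ_[2])‖ ≤ 1) : ‖constantCoeff L₀‖ ≤ 4⁻¹ := by
  have hl : ((constantCoeff L₀ : ℤ_[2]) : ℚ_[2]) = constantCoeff (padicLFunction f (unitRoot W 2 : ℚ_[2])) := by
    rw [← hL₀, ← coeff_zero_eq_constantCoeff_apply, ← coeff_zero_eq_constantCoeff_apply]
    exact (Wuthrich2014.coeff_iwasawaToPowerSeries 2 L₀ 0).symm
  rw [PadicInt.norm_def, hl]
  calc ‖constantCoeff (padicLFunction f (unitRoot W 2 : ℚ_[2]))‖ ≤ 4⁻¹ * ‖(ratPlusSymbol f 0 : ℚ_[2])‖ :=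
        norm_constantCoeff_padicLFunction_le hord hf
    _ ≤ 4⁻¹ * 1 := by gcongr
    _ = 4⁻¹ := mul_one _

/-! ## §3 `λ₂ ≥ 3` on the road under `μ₂ = 0` -/

/-- **`λ₂ ≥ 3` ON THE ROAD UNDER `μ₂ = 0`.** Let `W/ℚ` be globally minimal, good ordinary at `2`, with `∏ c_v` odd,
`Δ_min ≡ 3` or `5 (mod 8)` and `r_an(W) = 0`; `f` its newform at level `N_W`; `L₀ ∈ ℤ₂⟦T⟧` the integral lift of `L₂(W,T)`
(`ι L₀ = L₂`). If `μ(L₀) = 0` (crux C2's analytic `μ`-hypothesis for this carrier) and the central modular symbol `[0]⁺_f ∈ ℚ` is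
`2`-integral, then **`λ(L₀) ≥ 3`**: `λ(L₀)` is odd and `(T+2) ∣ L₀` (companion file), and `λ(L₀) = 1` would make `L₀ = (T+2)·u` with
`u` a unit (`λ = 1` dichotomy, `μ = 0`), so `‖L₀(0)‖₂ = ‖2u(0)‖₂ = ½` — but `‖L₀(0)‖₂ ≤ ¼` (§2). The road's curves are never
`λ`-minimal: `L₂(W,T)` has at least TWO further zeros in the open disc beyond the forced one at `T = −2` (an `ι`-pair
`{u, (1+u)⁻¹ − 1}`). [cite: GreenbergLNM1716, §5 p. 181] -/
theorem three_le_lam_integralLift_of_road (hord : IsOrdinaryAt W 2) (hf : IsNewformOf W f) (hodd : Odd W.tamagawaProduct)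
    (hΔ : minimalDiscriminantInt W % 8 = 3 ∨ minimalDiscriminantInt W % 8 = 5) (hr : W.analyticRank = 0)
    {L₀ : PowerSeries ℤ_[2]} (hL₀ : iwasawaToPowerSeries 2 L₀ = padicLFunction f (unitRoot W 2 : ℚ_[2]))
    (hμ : mu L₀ = 0) (hsym : ‖(ratPlusSymbol f 0 : ℚ_[2])‖ ≤ 1) : 3 ≤ lam L₀ := by
  have hg : iwasawaToPowerSeries 2 L₀ = C (1 : ℚ_[2]) * padicLFunction f (unitRoot W 2 : ℚ_[2]) := by
    rw [map_one, one_mul]; exact hL₀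
  have h0 : constantCoeff L₀ ≠ 0 := constantCoeff_ne_zero_of_analyticRank_eq_zero hord hf hr one_ne_zero hg
  have hL : L₀ ≠ 0 := fun h => h0 (by rw [h, map_zero])
  rcases three_le_lam_or_of_odd_lam hL (X_add_C_two_dvd_of_road hord hf hodd hΔ hr hg)
    (odd_lam_of_road hord hf hodd hΔ hg hL) with h3 | ⟨u, hu, hfac⟩
  · exact h3
  · exfalso
    -- `pfree L₀ = L₀` since `μ = 0`
    have hpf : pfree L₀ = L₀ := by
      have := eq_C_pow_mu_mul_pfree (p := 2) L₀
      rw [hμ, pow_zero, map_one, one_mul] at this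
      exact this.symm
    rw [hpf] at hfac
    have hc : constantCoeff L₀ = 2 * constantCoeff u := by
      rw [hfac, map_mul, map_add, constantCoeff_X, constantCoeff_C, zero_add]
    have hu1 : ‖constantCoeff u‖ = 1 := PadicInt.isUnit_iff.mp (PowerSeries.isUnit_iff_constantCoeff.mp hu)
    have hnorm : ‖constantCoeff L₀‖ = 2⁻¹ := by
      rw [hc, norm_mul, hu1, mul_one, show (2 : ℤ_[2]) = ((2 : ℕ) : ℤ_[2]) by norm_cast, PadicInt.norm_p]; norm_num
    have hle := norm_constantCoeff_integralLift_le hord hf hL₀ hsym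
    rw [hnorm] at hle
    norm_num at hle

/-- The same for C2's even-branch lift (`IsEvenBranchLiftAtTwo W f L₀`, `W` good at `2`). [cite: GreenbergLNM1716, §5 p. 181] -/
theorem three_le_lam_of_isEvenBranchLiftAtTwo_of_road (hgood : W.HasGoodReductionAtPrime 2) (hf : IsNewformOf W f)
    (hodd : Odd W.tamagawaProduct) (hΔ : minimalDiscriminantInt W % 8 = 3 ∨ minimalDiscriminantInt W % 8 = 5)
    (hr : W.analyticRank = 0) {L₀ : IwasawaAlgebra 2} (hG : IsEvenBranchLiftAtTwo W f L₀)
    (hμ : mu L₀ = 0) (hsym : ‖(ratPlusSymbol f 0 : ℚ_[2])‖ ≤ 1) : 3 ≤ lam L₀ := by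
  obtain ⟨hord, hL₀⟩ := isOrdinaryAt_and_eq_of_isEvenBranchLiftAtTwo hgood hG
  rw [map_one, one_mul] at hL₀
  exact three_le_lam_integralLift_of_road hord hf hodd hΔ hr hL₀ hμ hsym

/-! ## §4 In the road's own currency: `‖[0]⁺_f‖₂ = 1` from «`ord₂(L(W,1)/Ω_W) = 0`» and the period ratio at `2` -/

/-- **`‖[0]⁺_f‖₂ = 1` from the road's `L`-value bit.** For `W` good at `2` with `E[2]` irreducible and newform `f`: granted the tree's
named fact `realPeriodRat_eq_unit_mul_plusPeriod_two` (`Ω_W = u·Ω⁺_f`, `‖u‖₂ = 1` — the `E[2]`-irreducible slice of Abbes–Ullmo at `2`,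
one of the road's PRINT⁵ inputs), the road's «`L(W,1)/Ω_W = q`, `ord₂ q = 0`» gives `[0]⁺_f = L(W,1)/Ω⁺_f = q·u`, a `2`-adic unit.
[cite: AbbesUllmo1996, Thm. A] -/
theorem norm_ratPlusSymbol_zero_eq_one_of_lValue (hper : realPeriodRat_eq_unit_mul_plusPeriod_two)
    (hgood : W.HasGoodReductionAtPrime 2) (hirr : W.HasIrreducibleModPGaloisRep 2) (hf : IsNewformOf W f)
    (hL : ∃ q : ℚ, q ≠ 0 ∧ W.entireLFunction 1 / (W.realPeriodRat : ℂ) = (q : ℂ) ∧ padicValRat 2 q = 0) :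
    ‖(ratPlusSymbol f 0 : ℚ_[2])‖ = 1 := by
  obtain ⟨u, hu1, hΩ⟩ := hper W hgood hirr f hf
  obtain ⟨q, hq0, hL, hq⟩ := hL
  have hΩpos : 0 < W.realPeriodRat := W.realPeriodRat_pos_holds
  have hΩC : (W.realPeriodRat : ℂ) ≠ 0 := Complex.ofReal_ne_zero.mpr hΩpos.ne'
  have hL1 : W.entireLFunction 1 = (q : ℂ) * (W.realPeriodRat : ℂ) := by rw [← hL, div_mul_cancel₀ _ hΩC]
  have hre : (W.entireLFunction 1).re = (q : ℝ) * W.realPeriodRat := by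
    rw [hL1, show ((q : ℂ)) = ((q : ℝ) : ℂ) by norm_cast, ← Complex.ofReal_mul, Complex.ofReal_re]
  have hsym := hf.ratPlusSymbol_zero_mul_plusPeriod
  have hpos : 0 < plusPeriod f := IsNewform0.plusPeriod_pos_holds hf.1 hf.coeffField_eq_bot
  have key : ((ratPlusSymbol f 0 : ℚ) : ℝ) = ((q * u : ℚ) : ℝ) := by
    have h : ((ratPlusSymbol f 0 : ℚ) : ℝ) * plusPeriod f = (((q * u : ℚ)) : ℝ) * plusPeriod f := by
      rw [hsym, hre, hΩ]; push_cast; ring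
    exact mul_right_cancel₀ hpos.ne' h
  have key' : ratPlusSymbol f 0 = q * u := by exact_mod_cast key
  have hqn : ‖(q : ℚ_[2])‖ = 1 := by
    rw [Padic.eq_padicNorm, padicNorm.eq_zpow_of_nonzero hq0, hq]; simp
  rw [key', Rat.cast_mul, norm_mul, hqn, hu1, mul_one]

/-- **`λ₂ ≥ 3` ON THE ROAD, in the road's currency.** `W` globally minimal, good ordinary at `2`, `E[2]` irreducible, `∏ c_v` odd,
`Δ_min ≡ 3, 5 (mod 8)`, `r_an(W) = 0`, «`L(W,1)/Ω_W = q`, `ord₂ q = 0`» (the odd-`L/Ω` branch of the road), `f` its newform at level `N_W`,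
`L₀` the integral lift of `L₂(W,T)` with `μ(L₀) = 0`; PRINT input displayed: `realPeriodRat_eq_unit_mul_plusPeriod_two`. Then `3 ≤ λ(L₀)`.
[cite: GreenbergLNM1716, §5 p. 181] -/
theorem three_le_lam_integralLift_of_road_of_lValue (hper : realPeriodRat_eq_unit_mul_plusPeriod_two)
    (hord : IsOrdinaryAt W 2) (hirr : W.HasIrreducibleModPGaloisRep 2) (hf : IsNewformOf W f) (hodd : Odd W.tamagawaProduct)
    (hΔ : minimalDiscriminantInt W % 8 = 3 ∨ minimalDiscriminantInt W % 8 = 5) (hr : W.analyticRank = 0)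
    (hL : ∃ q : ℚ, q ≠ 0 ∧ W.entireLFunction 1 / (W.realPeriodRat : ℂ) = (q : ℂ) ∧ padicValRat 2 q = 0)
    {L₀ : PowerSeries ℤ_[2]} (hL₀ : iwasawaToPowerSeries 2 L₀ = padicLFunction f (unitRoot W 2 : ℚ_[2]))
    (hμ : mu L₀ = 0) : 3 ≤ lam L₀ :=
  three_le_lam_integralLift_of_road hord hf hodd hΔ hr hL₀ hμ
    (norm_ratPlusSymbol_zero_eq_one_of_lValue hper hord.1 hirr hf hL).le

/-! ## §5 (appended, same gen) On the road `λ₂ ≥ ord_{T=−2} L₂ + 2`: at least one `ι`-pair of zeros off the two fixed points -/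

/-- `μ((T+2)^n) = 0` and `λ((T+2)^n) = n`. [folklore] -/
theorem mu_and_lam_X_add_C_two_pow (n : ℕ) :
    mu ((X + C (2 : ℤ_[2])) ^ n : PowerSeries ℤ_[2]) = 0 ∧ lam ((X + C (2 : ℤ_[2])) ^ n : PowerSeries ℤ_[2]) = n := by
  have hX0 : (X + C (2 : ℤ_[2]) : PowerSeries ℤ_[2]) ≠ 0 := prime_X_add_C_two.ne_zero
  induction n with
  | zero =>
    have h := (isUnit_iff_mu_eq_zero_and_lam_eq_zero (1 : PowerSeries ℤ_[2])).mp isUnit_one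
    rw [pow_zero]; exact ⟨h.2.1, h.2.2⟩
  | succ n ih =>
    have hpow : ((X + C (2 : ℤ_[2])) ^ n : PowerSeries ℤ_[2]) ≠ 0 := pow_ne_zero _ hX0
    rw [pow_succ, mu_mul hpow hX0, lam_mul hpow hX0, ih.1, ih.2, mu_X_add_C_two_and_pfree.1, lam_X_add_C_two]
    exact ⟨rfl, rfl⟩

/-- The `2`-adic norm of a non-zero natural number is an INTEGER power of `½`. [folklore] -/
theorem exists_norm_natCast_eq_two_inv_pow {m : ℕ} (hm : m ≠ 0) : ∃ v : ℕ, ‖(m : ℚ_[2])‖ = (2⁻¹ : ℝ) ^ v := by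
  obtain ⟨v, m', hm', rfl⟩ := Nat.exists_eq_two_pow_mul_odd hm
  refine ⟨v, ?_⟩
  have hodd : ¬ (2 : ℤ) ∣ (m' : ℤ) := by
    intro h; exact hm'.not_two_dvd_nat (by exact_mod_cast h)
  have h1 : ‖((m' : ℤ) : ℚ_[2])‖ = 1 := norm_intCast_eq_one_of_odd hodd
  have h2 : ‖(2 : ℚ_[2])‖ = 2⁻¹ := by
    rw [show (2 : ℚ_[2]) = ((2 : ℕ) : ℚ_[2]) by norm_cast, Padic.norm_p]; norm_num
  push_cast
  rw [norm_mul, norm_pow, h2, show ((m' : ℚ_[2])) = ((m' : ℤ) : ℚ_[2]) by norm_cast, h1, mul_one]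

/-- **ON THE ROAD `λ₂ ≥ ord_{T=−2} L₂ + 2`: the `2`-adic `L`-function has at least one `ι`-PAIR of zeros off the two fixed points.**
Same hypotheses as `three_le_lam_integralLift_of_road` but with the exact unit `‖[0]⁺_f‖₂ = 1` (the road's odd-`L/Ω` branch, §4): if `L₀` has
order `n` at `T = −2` then `n + 2 ≤ λ(L₀)`. Proof: `n ≤ λ`, both odd; `λ = n` would make `L₀ = (T+2)^n·H` with `λ(H) = μ(H) = 0`, i.e. `H` a
unit, so `‖L₀(0)‖₂ = 2^{−n}` with `n` ODD — but `‖L₀(0)‖₂ = ‖#Ẽ(𝔽₂)‖₂²·‖[0]⁺_f‖₂ = 4^{−v}` is an EVEN power of `½` (§2). So the excess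
`λ₂ − ord₋₂ L₂` is even and POSITIVE: beyond the forced odd-order zero at `χ₈` there is a genuine pair `{u, (1+u)⁻¹ − 1}` of zeros in the open disc
(crux memo CHI8-TWIST-att-p5-g32 §6: `λ₂ ∈ {3,5,7,11,15}` on 19/19 road curves). [cite: GreenbergLNM1716, §5 p. 181] -/
theorem orderAtNegTwo_add_two_le_lam_integralLift_of_road (hord : IsOrdinaryAt W 2) (hf : IsNewformOf W f)
    (hodd : Odd W.tamagawaProduct) (hΔ : minimalDiscriminantInt W % 8 = 3 ∨ minimalDiscriminantInt W % 8 = 5) (hr : W.analyticRank = 0)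
    {L₀ : PowerSeries ℤ_[2]} (hL₀ : iwasawaToPowerSeries 2 L₀ = padicLFunction f (unitRoot W 2 : ℚ_[2]))
    (hμ : mu L₀ = 0) (hsym : ‖(ratPlusSymbol f 0 : ℚ_[2])‖ = 1) {n : ℕ} (hn : HasOrderAtNegTwo L₀ n) :
    n + 2 ≤ lam L₀ := by
  have hg : iwasawaToPowerSeries 2 L₀ = C (1 : ℚ_[2]) * padicLFunction f (unitRoot W 2 : ℚ_[2]) := by
    rw [map_one, one_mul]; exact hL₀
  have hL : L₀ ≠ 0 := ne_zero_of_hasOrderAtNegTwo hn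
  have hnle : n ≤ lam L₀ := le_lam_of_X_add_C_two_pow_dvd hL hn.1
  have hnodd : Odd n := odd_orderAtNegTwo_of_road hord hf hodd hΔ hr hg hn
  have hlamodd : Odd (lam L₀) := odd_lam_of_road hord hf hodd hΔ hg hL
  by_contra hlt
  have heq : lam L₀ = n := by
    obtain ⟨a, ha⟩ := hnodd; obtain ⟨b, hb⟩ := hlamodd; omega
  -- `L₀ = (T+2)^n · H` with `H` a unit
  obtain ⟨H, hH⟩ := hn.1
  have hX0 : (X + C (2 : ℤ_[2]) : PowerSeries ℤ_[2]) ≠ 0 := prime_X_add_C_two.ne_zero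
  have hpow : ((X + C (2 : ℤ_[2])) ^ n : PowerSeries ℤ_[2]) ≠ 0 := pow_ne_zero _ hX0
  have hH0 : H ≠ 0 := by rintro rfl; exact hL (by rw [hH, mul_zero])
  obtain ⟨hμn, hlamn⟩ := mu_and_lam_X_add_C_two_pow n
  have hHunit : IsUnit H := by
    rw [isUnit_iff_mu_eq_zero_and_lam_eq_zero]
    have h1 := mu_mul hpow hH0
    have h2 := lam_mul hpow hH0
    rw [← hH] at h1 h2
    refine ⟨hH0, by omega, by omega⟩
  -- `‖L₀(0)‖ = 2^{-n}`
  have hc : constantCoeff L₀ = (2 : ℤ_[2]) ^ n * constantCoeff H := by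
    rw [hH, map_mul, map_pow, map_add, constantCoeff_X, constantCoeff_C, zero_add]
  have hHn : ‖constantCoeff H‖ = 1 := PadicInt.isUnit_iff.mp (PowerSeries.isUnit_iff_constantCoeff.mp hHunit)
  have h2n : ‖(2 : ℤ_[2])‖ = 2⁻¹ := by
    rw [show (2 : ℤ_[2]) = ((2 : ℕ) : ℤ_[2]) by norm_cast, PadicInt.norm_p]; norm_num
  have hnormL : ‖constantCoeff L₀‖ = (2⁻¹ : ℝ) ^ n := by
    rw [hc, norm_mul, norm_pow, h2n, hHn, mul_one]
  -- `‖L₀(0)‖ = ‖#Ẽ(𝔽₂)‖²`, an even power of `½`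
  have hl : ((constantCoeff L₀ : ℤ_[2]) : ℚ_[2]) = constantCoeff (padicLFunction f (unitRoot W 2 : ℚ_[2])) := by
    rw [← hL₀, ← coeff_zero_eq_constantCoeff_apply, ← coeff_zero_eq_constantCoeff_apply]
    exact (Wuthrich2014.coeff_iwasawaToPowerSeries 2 L₀ 0).symm
  haveI : NeZero (2 : ℕ) := ⟨two_ne_zero⟩
  obtain ⟨v, hv⟩ := exists_norm_natCast_eq_two_inv_pow (W.reductionPointCount_pos 2).ne'
  have hnormL' : ‖constantCoeff L₀‖ = (2⁻¹ : ℝ) ^ (2 * v) := by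
    rw [PadicInt.norm_def, hl, norm_constantCoeff_padicLFunction_eq hord hf, hsym, mul_one, hv, ← pow_mul, mul_comm]
  have hninj : n = 2 * v :=
    pow_right_injective₀ (by norm_num : (0 : ℝ) < 2⁻¹) (by norm_num : (2⁻¹ : ℝ) ≠ 1) (hnormL.symm.trans hnormL')
  obtain ⟨a, ha⟩ := hnodd
  omega

/-- **`λ₂ ≥ ord₋₂ + 2` in the road's currency** (`hper` + «`L(W,1)/Ω_W = q`, `ord₂ q = 0`» give `‖[0]⁺_f‖₂ = 1`, §4).
[cite: GreenbergLNM1716, §5 p. 181] -/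
theorem orderAtNegTwo_add_two_le_lam_integralLift_of_road_of_lValue (hper : realPeriodRat_eq_unit_mul_plusPeriod_two)
    (hord : IsOrdinaryAt W 2) (hirr : W.HasIrreducibleModPGaloisRep 2) (hf : IsNewformOf W f) (hodd : Odd W.tamagawaProduct)
    (hΔ : minimalDiscriminantInt W % 8 = 3 ∨ minimalDiscriminantInt W % 8 = 5) (hr : W.analyticRank = 0)
    (hL : ∃ q : ℚ, q ≠ 0 ∧ W.entireLFunction 1 / (W.realPeriodRat : ℂ) = (q : ℂ) ∧ padicValRat 2 q = 0)
    {L₀ : PowerSeries ℤ_[2]} (hL₀ : iwasawaToPowerSeries 2 L₀ = padicLFunction f (unitRoot W 2 : ℚ_[2]))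
    (hμ : mu L₀ = 0) {n : ℕ} (hn : HasOrderAtNegTwo L₀ n) : n + 2 ≤ lam L₀ :=
  orderAtNegTwo_add_two_le_lam_integralLift_of_road hord hf hodd hΔ hr hL₀ hμ
    (norm_ratPlusSymbol_zero_eq_one_of_lValue hper hord.1 hirr hf hL) hn

end Summit.BirchSwinnertonDyer.BirchSwinnertonDyer.Theorems.AlignedTransportAtTwoRoadSecondFixedPoint

end
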